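import Literature.NumberTheory.Automorphic.UnitaryLatticeTreePeriodRelation          -- ★ (this seat) (G1) COSET SIDE: `natCard_quotient_fixedBy_add_eq_natCard_quotient_fixedBy_inf_three` on any model `eU : G ≃* U(σ, J₀)`
import Literature.NumberTheory.Automorphic.UnitaryLatticeTreePeriodRelationRamified  -- ★ p852982 (F0P2-p02 (g25), ED. 2 §4): `natCard_quotient_fixedBy_add_eq_natCard_quotient_fixedBy_inf_three_of_transitive` ∕ `…_of_neg`; brings ★ `…EulerRelationRamified` (`forall_flag_exists_unitary_of_v_two`)
import Literature.NumberTheory.Automorphic.OrbitalIntegralFixedPointsPerPeriodTorus    -- ★ the per-period ENGINE `classOrbitalIntegral_indicator(_complex)_eq_mul_natCard_quotient_zpowers`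
import Literature.NumberTheory.Automorphic.OrbitalMeasureCanonicalExistsCM             -- ★ `compactCore_centralizer_local_facts_of_isRegularElt`
import Literature.NumberTheory.Automorphic.UnitaryUnitOrbitalIntegralFixedPoints       -- ★ `isRegularElt_val_conj`, `isClosed_conjClass_local_of_isRegularElt`, the `U(H)(L⁺_v)` instances
import Literature.NumberTheory.Automorphic.LocalUnitaryGroupCongr                      -- ★ `antidiagOne_eq_over`, `antidiagOne_isHermitian`, `isUnit_antidiagOne_det`
import HarnessLib

/-!
# Kottwitz's NON-ELLIPTIC relation for the Euler–Poincaré function of the quasi-split `U(3)` at an inert place — the `hN` binder of ★ `RankOneEulerPoincareGlue`, assembled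
# from the lattice-tree relation ★ `UnitaryLatticeTreePeriodRelation` and the ★ per-period engine, WITH THE SPLIT-TORUS KIT AS BINDERS (Kottwitz 1988 §2 Thm. 2)

Topic `NumberTheory/Rogawski1990`, namespace `Literature.NumberTheory.Rogawski1990`.  THEOREMS ONLY (no definition ∕ instance ∕ notation ∕ named fact ∕ `sorry`).
Cell `pub/hodgecm-mathlib`, crux H413 = `stmt-HodgeConjecture-24833` (`--supports` lane, helper), LH6 rung-0 residue, CENSUS «EP-G» v1 (F0P3a-p09) §5 brick (G1) «(N)-G»,
ASSEMBLY FILE; seat LH6-p03 (g8).  This is the `U(3)` twin of ★ `RankOneEulerPoincareNonsplitNonEllipticOfTreeActionLevels.epNonEllipticCombination_eq_zero_of_vertexAction_of_levels`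
(A-p06 (g28), `U(Φ₂)`): the tree-side combinatorics is NOT a binder here (it is ★ `UnitaryLatticeTreePeriodRelation` + ★ `TreeActionLinePerPeriod`), but the two facts of the
SPLIT-TORUS KIT (census (G1c), dealt to LH10-p02) ARE carried BY SHAPE as binders `hT1`, `hT2` until they land.  HONEST LABEL: count-neutral (orbital-integral bookkeeping over ★
engines; nothing printed is asserted); HC_CM is proved only modulo the 7 printed citations (2 remaining named inputs hLiu418 = stmt-HodgeConjecture-24832, h413 = stmt-HodgeConjecture-24833)
until rung 0 closes.

THE THEOREM (`epNonEllipticCombination_eq_zero_three`).  `L` CM, `v` a finite place of `L⁺` with a place `w ∣ v` of `L` FIXED by complex conjugation (non-split), `E = L_w`,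
`σ = σ_w`, `G = U(Φ₃)(L⁺_v) = (cmDatum L 3 Φ₃).Local v`, `e_w = localNonsplitEquiv : G ≃* U(σ, Φ₃)(E)`; an UNRAMIFIED datum `hd : UnramifiedLocalConjDatum σ ϖ` on `E` (inert `w`);
`g₁ = diag(1,1,ϖ)`; compact open subgroups `Kv, Ke, I ≤ G` GIVEN BY MEMBERSHIP through `e_w`: `Kv ↔ GL₃(𝒪_w)` (hyperspecial `K₀`), `Ke ↔ g₁ GL₃(𝒪_w) g₁⁻¹` (the type-two vertex
stabiliser `K₁`), `I ↔` both (the Iwahori); `ν` Haar, `m` CANONICAL for the regular classes.  KIT BINDERS: (T1) `hT1` — every regular `γ` with NON-compact centraliser is `G`-conjugate to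
an element whose one-place matrix is DIAGONAL of valuation profile `(|ϖ^c|, 1, |ϖ^{−c}|)`; (T2) `hT2` — for such a regular diagonal `δ`, `Z_G(δ)` contains `τ` with one-place matrix
`diag(ϖ⁻¹, 1, ϖ)` generating `Z_G(δ)` modulo its compact core and meeting the compact core only trivially (the `hgen`∕`hfree` binders of the ★ engine).  CONCLUSION, for every regular `γ`
with non-compact centraliser: `((ν Kv).toReal : ℂ)⁻¹ Φ(⟦γ⟧, 𝟙_{Kv}) + ((ν Ke).toReal : ℂ)⁻¹ Φ(⟦γ⟧, 𝟙_{Ke}) − ((ν I).toReal : ℂ)⁻¹ Φ(⟦γ⟧, 𝟙_I) = 0` — the `hN` binder of ★ GLUE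
`exists_isLocSmooth_classOrbitalIntegral_eq_one_zero_of_relations` VERBATIM at `(K, K′, I) := (Kv, Ke, I)`.
PROOF: both sides are class functions, so pass to the diagonal representative `δ` (T1); the ★ engine ×3 (`Φ(⟦δ⟧, 𝟙_C) = ν(C)·#(Fix_δ(G⧸C)∕τ^ℤ)`, closed class ★
`isClosed_conjClass_local_of_isRegularElt`, compact-core facts ★ `compactCore_centralizer_local_facts_of_isRegularElt`, `τ` from (T2)); cancel the volumes; the remaining identity of
natural numbers is ★ `natCard_quotient_fixedBy_add_eq_natCard_quotient_fixedBy_inf_three` on the model `e_w` (cast to the `J₀ = (StdForm.antidiagonal 3).over E` spelling of the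
lattice-tree files by ★ `antidiagOne_eq_over`).

## References
* [Kottwitz1988] R. E. Kottwitz, *Tamagawa numbers*, Ann. of Math. 127 (1988), 629–646, §2 Theorem 2 (non-elliptic case `O_γ(f_EP) = 0`).
* [Serre1980Trees] J.-P. Serre, *Trees* (1980), I.6.4, II.1.1.
* [Laumon1995] G. Laumon, *Cohomology of Drinfeld Modular Varieties* I (1996), Lemma (5.3.2) p. 136.
* [Rogawski1990] J. D. Rogawski, *Automorphic Representations of Unitary Groups in Three Variables* (1990), §12.3 p. 176; §3.6 pp. 28–29; §4.9 p. 54.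
* [Tits1979] J. Tits, *Reductive groups over local fields*, PSPM 33.1 (1979), §2.4, §3.3.3.
-/

set_option autoImplicit false

noncomputable section

open scoped ValuativeRel Matrix MatrixGroups WithZero Valued
open Matrix NumberField IsDedekindDomain MulAction MeasureTheory Measure Topology

namespace Literature.NumberTheory.Rogawski1990

open Literature.NumberTheory.Automorphic Literature.NumberTheory.Automorphic.UnitaryGroup Literature.NumberTheory.Automorphic.UnitaryLatticeTree
  Literature.NumberTheory.Automorphic.HermitianLattice Literature.NumberTheory.GaloisRepresentations

/-! ## §1 Volumes of compact open subgroups -/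

section Volume

/-- `((ν K).toReal : ℂ) ≠ 0` for a compact open subgroup under a Haar measure. [cite: Kottwitz1988, §2] -/
theorem complex_toReal_measure_ne_zero_of_isOpen_isCompact {H : Type*} [Group H] [TopologicalSpace H] [MeasurableSpace H]
    (ν : Measure H) [ν.IsHaarMeasure] (K : Subgroup H) (hK : IsOpen (K : Set H)) (hKc : IsCompact (K : Set H)) :
    (((ν K).toReal : ℝ) : ℂ) ≠ 0 := by
  rw [Ne, Complex.ofReal_eq_zero, ENNReal.toReal_eq_zero_iff, not_or]
  exact ⟨(hK.measure_pos ν ⟨1, K.one_mem⟩).ne', hKc.measure_lt_top.ne⟩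

end Volume

/-! ## §2 The generic assembly: any topological group with a lattice model `eU : G ≃* U(σ, J₀)` -/

section Generic

variable {G : Type*} [Group G] [TopologicalSpace G] [IsTopologicalGroup G] [LocallyCompactSpace G]
  [SecondCountableTopology G] [T2Space G] [MeasurableSpace G] [BorelSpace G]
  [∀ γ : G, MeasurableSpace (G ⧸ Subgroup.centralizer ({γ} : Set G))]
  [∀ γ : G, BorelSpace (G ⧸ Subgroup.centralizer ({γ} : Set G))]
  {K : Type*} [Field K] [Valued K ℤᵐ⁰] [ValuativeRel K] [(Valued.v : Valuation K ℤᵐ⁰).Compatible] {σ : K →+* K} {ϖ : K}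

/-- **THE GENERIC ASSEMBLY (THEOREM C₃).**  `G` a locally compact group with a Haar measure `ν` and a canonical orbital family `m` for a class predicate `P`; a lattice MODEL
`eU : G ≃* U(σ, H′)` with `H′ = J₀` up to the spelling `hH′` (`hd` an unramified datum on `K`); levels `Kv, Ke, I ≤ G` compact open, given by membership through `eU` (`GL₃(𝒪)`, `g₁GL₃(𝒪)g₁⁻¹`, both; `g₁ = diag(1,1,ϖ)`);
`δ ∈ G` with `P δ`, closed class, commutative centraliser with compact open compact core, `eU δ` DIAGONAL of valuation profile `(|ϖ^c|, 1, |ϖ^{−c}|)`; `τ ∈ Z_G(δ)` with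
`eU τ = diag(ϖ⁻¹, 1, ϖ)` and (gen)∕(free).  Then `((ν Kv).toReal : ℂ)⁻¹ Φ(⟦δ⟧, 𝟙_{Kv}) + ((ν Ke).toReal : ℂ)⁻¹ Φ(⟦δ⟧, 𝟙_{Ke}) − ((ν I).toReal : ℂ)⁻¹ Φ(⟦δ⟧, 𝟙_I) = 0`
(★ engine ×3, volumes cancelled, ★ `natCard_quotient_fixedBy_add_eq_natCard_quotient_fixedBy_inf_three`). [cite: Kottwitz1988, §2 Theorem 2] [cite: Laumon1995, Lemma (5.3.2) p. 136]
[cite: Serre1980Trees, I.6.4; II.1.1] -/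
theorem epCombination_classOrbitalIntegral_eq_zero_of_latticeModel_three {P : G → Prop} (hP : ∀ g x : G, P g → P (x * g * x⁻¹))
    {ν : Measure G} [ν.IsHaarMeasure] [ν.IsMulRightInvariant] {m : OrbitalMeasureFamily G} (hm : m.IsCanonical P ν)
    (hd : UnramifiedLocalConjDatum σ ϖ) (g₁ : GL (Fin 3) K) (hg₁ : (g₁ : Matrix (Fin 3) (Fin 3) K) = diagonal ![(1 : K), 1, ϖ])
    {H' : Matrix (Fin 3) (Fin 3) K} (hH' : H' = (StdForm.antidiagonal 3).over K) (eU : G ≃* ↥(unitaryGroupOfForm σ H')) (Kv Ke I : Subgroup G)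
    (hKv : ∀ g : G, g ∈ Kv ↔ ((eU g : ↥(unitaryGroupOfForm σ H')) : GL (Fin 3) K) ∈ glInt 3 K)
    (hKe : ∀ g : G, g ∈ Ke ↔ ((eU g : ↥(unitaryGroupOfForm σ H')) : GL (Fin 3) K) ∈ (glInt 3 K).map (MulAut.conj g₁).toMonoidHom)
    (hI : ∀ g : G, g ∈ I ↔ ((eU g : ↥(unitaryGroupOfForm σ H')) : GL (Fin 3) K) ∈ glInt 3 K ∧ ((eU g : ↥(unitaryGroupOfForm σ H')) : GL (Fin 3) K) ∈ (glInt 3 K).map (MulAut.conj g₁).toMonoidHom)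
    (hKvo : IsOpen (Kv : Set G)) (hKvc : IsCompact (Kv : Set G)) (hKeo : IsOpen (Ke : Set G)) (hKec : IsCompact (Ke : Set G))
    (hIo : IsOpen (I : Set G)) (hIc : IsCompact (I : Set G))
    {δ : G} (hδ : P δ) (hO : IsClosed {g | ∃ y : G, y * δ * y⁻¹ = g})
    (hcomm : ∀ a b : Subgroup.centralizer ({δ} : Set G), a * b = b * a)
    (hc : IsCompact (compactCore (Subgroup.centralizer ({δ} : Set G)))) (ho : IsOpen (compactCore (Subgroup.centralizer ({δ} : Set G))))
    (τ : Subgroup.centralizer ({δ} : Set G))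
    (hgen : ∀ c' : Subgroup.centralizer ({δ} : Set G), ∃ n : ℤ, c' * (τ ^ n)⁻¹ ∈ compactCore (Subgroup.centralizer ({δ} : Set G)))
    (hfree : ∀ n : ℤ, τ ^ n ∈ compactCore (Subgroup.centralizer ({δ} : Set G)) → n = 0)
    (hτm : (((eU (τ : G) : ↥(unitaryGroupOfForm σ H')) : GL (Fin 3) K) : Matrix (Fin 3) (Fin 3) K) = diagonal ![ϖ⁻¹, 1, ϖ]) {e : Fin 3 → K}
    (hδm : (((eU δ : ↥(unitaryGroupOfForm σ H')) : GL (Fin 3) K) : Matrix (Fin 3) (Fin 3) K) = diagonal e) {c : ℤ}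
    (he₀ : Valued.v (e 0) = Valued.v (ϖ ^ c)) (he₁ : Valued.v (e 1) = 1) (he₂ : Valued.v (e 2) = Valued.v (ϖ ^ (-c))) :
    (((ν Kv).toReal : ℂ))⁻¹ * classOrbitalIntegral m ((Kv : Set G).indicator fun _ => (1 : ℂ)) (ConjClasses.mk δ) +
        (((ν Ke).toReal : ℂ))⁻¹ * classOrbitalIntegral m ((Ke : Set G).indicator fun _ => (1 : ℂ)) (ConjClasses.mk δ) -
        (((ν I).toReal : ℂ))⁻¹ * classOrbitalIntegral m ((I : Set G).indicator fun _ => (1 : ℂ)) (ConjClasses.mk δ) = 0 := by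
  subst hH'
  rw [classOrbitalIntegral_indicator_complex_eq_mul_natCard_quotient_zpowers hP hm hδ hcomm hc ho τ hgen hfree Kv hKvo hKvc hO,
    classOrbitalIntegral_indicator_complex_eq_mul_natCard_quotient_zpowers hP hm hδ hcomm hc ho τ hgen hfree Ke hKeo hKec hO,
    classOrbitalIntegral_indicator_complex_eq_mul_natCard_quotient_zpowers hP hm hδ hcomm hc ho τ hgen hfree I hIo hIc hO]
  have hfinA := (classOrbitalIntegral_indicator_eq_mul_natCard_quotient_zpowers hP hm hδ hcomm hc ho τ hgen hfree Kv hKvo hKvc hO).1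
  have hfinB := (classOrbitalIntegral_indicator_eq_mul_natCard_quotient_zpowers hP hm hδ hcomm hc ho τ hgen hfree Ke hKeo hKec hO).1
  rw [← mul_assoc, ← mul_assoc, ← mul_assoc, inv_mul_cancel₀ (complex_toReal_measure_ne_zero_of_isOpen_isCompact ν Kv hKvo hKvc),
    inv_mul_cancel₀ (complex_toReal_measure_ne_zero_of_isOpen_isCompact ν Ke hKeo hKec), inv_mul_cancel₀ (complex_toReal_measure_ne_zero_of_isOpen_isCompact ν I hIo hIc),
    one_mul, one_mul, one_mul, sub_eq_zero, ← Nat.cast_add, Nat.cast_inj]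
  have hτ : (τ : G) * δ = δ * (τ : G) := Subgroup.mem_centralizer_singleton_iff.1 τ.2
  have hτeq : (⟨(τ : G), Subgroup.mem_centralizer_singleton_iff.2 hτ⟩ : Subgroup.centralizer ({δ} : Set G)) = τ := Subtype.ext rfl
  have key := natCard_quotient_fixedBy_add_eq_natCard_quotient_fixedBy_inf_three hd g₁ hg₁ eU Kv Ke I hKv hKe hI (τ : G) δ hτm hδm he₀ he₁ he₂ hτ
  rw [hτeq] at key
  exact key hfinA hfinB

end Generic

/-! ## §3 The assembly on `U(Φ₃)(L⁺_v)` -/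

section Core

variable (L : Type) [Field L] [NumberField L] [IsCMField L] {v : HeightOneSpectrum (𝓞 ↥(maximalRealSubfield L))}
  (w : PlacesOver L v) (hw : IsCMField.complexConj L • w.1 = w.1)
  [MeasurableSpace ((cmDatum L 3 (Matrix.of fun i j : Fin 3 => if i.val + j.val + 1 = 3 then (1 : L) else 0)).Local v)] [BorelSpace ((cmDatum L 3 (Matrix.of fun i j : Fin 3 => if i.val + j.val + 1 = 3 then (1 : L) else 0)).Local v)]
  [∀ γ : (cmDatum L 3 (Matrix.of fun i j : Fin 3 => if i.val + j.val + 1 = 3 then (1 : L) else 0)).Local v,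
    MeasurableSpace (((cmDatum L 3 (Matrix.of fun i j : Fin 3 => if i.val + j.val + 1 = 3 then (1 : L) else 0)).Local v) ⧸ Subgroup.centralizer ({γ} : Set ((cmDatum L 3 (Matrix.of fun i j : Fin 3 => if i.val + j.val + 1 = 3 then (1 : L) else 0)).Local v)))]
  [∀ γ : (cmDatum L 3 (Matrix.of fun i j : Fin 3 => if i.val + j.val + 1 = 3 then (1 : L) else 0)).Local v,
    BorelSpace (((cmDatum L 3 (Matrix.of fun i j : Fin 3 => if i.val + j.val + 1 = 3 then (1 : L) else 0)).Local v) ⧸ Subgroup.centralizer ({γ} : Set ((cmDatum L 3 (Matrix.of fun i j : Fin 3 => if i.val + j.val + 1 = 3 then (1 : L) else 0)).Local v)))]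
  (ν : Measure ((cmDatum L 3 (Matrix.of fun i j : Fin 3 => if i.val + j.val + 1 = 3 then (1 : L) else 0)).Local v)) [IsHaarMeasure ν] [ν.IsMulRightInvariant]

omit [IsCMField L] in
/-- `(Φ₃)_w = J₀` in the `StdForm` spelling of the lattice-tree files. [cite: Rogawski1990, §3.6 p. 28] -/
theorem placeForm_antidiagThree_eq_over :
    placeForm (Matrix.of fun i j : Fin 3 => if i.val + j.val + 1 = 3 then (1 : L) else 0) w.1 = (StdForm.antidiagonal 3).over (w.1.adicCompletion L) := by
  rw [placeForm, antidiagOne_eq_over, StdForm.over_map]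

set_option maxHeartbeats 800000 in
-- see the docstring: the closing `exact` over the CM carrier needs > 200000 heartbeats at `whnf` (as in ★ `RankOneEulerPoincareNonsplitNonEllipticOfTreeActionLevels`)
include hw in
/-- **KOTTWITZ'S NON-ELLIPTIC RELATION FOR `f_EP` OF THE QUASI-SPLIT `U(3)` AT AN INERT PLACE, with the split-torus kit as binders.**  See the module docstring for the
hypotheses; conclusion = the `hN` binder of ★ `RankOneEulerPoincareGlue.exists_isLocSmooth_classOrbitalIntegral_eq_one_zero_of_relations` at `(Kv, Ke, I)`.
`maxHeartbeats 800000` (this declaration only; measured): the statement alone elaborates within the default 200000 (checked with the body sorried), but the closing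
`exact` of the generic §2 theorem at `eU := (localNonsplitEquiv …).toMulEquiv` must unify six orbital-integral terms and nine membership binders over the CM carrier
`(cmDatum L 3 Φ₃).Local v` and times out at `whnf` under the default; it closes under 800000 — the budget of ★ FILE A `RankOneEulerPoincareNonsplitNonEllipticOfTreeActionLevels`,
same cause.  The proof is (T1)∕(T2) unpacking, the two ★ regular-class facts, and that one `exact`.
[cite: Kottwitz1988, §2 Theorem 2] [cite: Serre1980Trees, I.6.4; II.1.1] [cite: Laumon1995, Lemma (5.3.2) p. 136] [cite: Rogawski1990, §12.3 p. 176; §3.6 pp. 28–29] [cite: Tits1979, §2.4] -/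
theorem epNonEllipticCombination_eq_zero_three
    {m : OrbitalMeasureFamily ((cmDatum L 3 (Matrix.of fun i j : Fin 3 => if i.val + j.val + 1 = 3 then (1 : L) else 0)).Local v)}
    (hm : m.IsCanonical (fun γ => IsRegularElt (γ.val : GL (Fin 3) (UnitaryGroup.LocalRing L v))) ν)
    {ϖ : w.1.adicCompletion L} (hd : UnramifiedLocalConjDatum (galAdicCompletionMap (L := L) (IsCMField.complexConj L) hw) ϖ)
    (g₁ : GL (Fin 3) (w.1.adicCompletion L)) (hg₁ : (g₁ : Matrix (Fin 3) (Fin 3) (w.1.adicCompletion L)) = diagonal ![(1 : w.1.adicCompletion L), 1, ϖ])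
    (Kv Ke I : Subgroup ((cmDatum L 3 (Matrix.of fun i j : Fin 3 => if i.val + j.val + 1 = 3 then (1 : L) else 0)).Local v))
    (hKv : ∀ g : (cmDatum L 3 (Matrix.of fun i j : Fin 3 => if i.val + j.val + 1 = 3 then (1 : L) else 0)).Local v,
      g ∈ Kv ↔ (((localNonsplitEquiv (IsCMField.complexConj L) (Matrix.of fun i j : Fin 3 => if i.val + j.val + 1 = 3 then (1 : L) else 0)
          (IsCMField.complexConj_ne_one L) w hw) g : ↥(unitaryGroupOfForm (galAdicCompletionMap (L := L) (IsCMField.complexConj L) hw)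
            (placeForm (Matrix.of fun i j : Fin 3 => if i.val + j.val + 1 = 3 then (1 : L) else 0) w.1))) : GL (Fin 3) (w.1.adicCompletion L)) ∈ glInt 3 (w.1.adicCompletion L))
    (hKe : ∀ g : (cmDatum L 3 (Matrix.of fun i j : Fin 3 => if i.val + j.val + 1 = 3 then (1 : L) else 0)).Local v,
      g ∈ Ke ↔ (((localNonsplitEquiv (IsCMField.complexConj L) (Matrix.of fun i j : Fin 3 => if i.val + j.val + 1 = 3 then (1 : L) else 0)
          (IsCMField.complexConj_ne_one L) w hw) g : ↥(unitaryGroupOfForm (galAdicCompletionMap (L := L) (IsCMField.complexConj L) hw)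
            (placeForm (Matrix.of fun i j : Fin 3 => if i.val + j.val + 1 = 3 then (1 : L) else 0) w.1))) : GL (Fin 3) (w.1.adicCompletion L)) ∈
        (glInt 3 (w.1.adicCompletion L)).map (MulAut.conj g₁).toMonoidHom)
    (hI : ∀ g : (cmDatum L 3 (Matrix.of fun i j : Fin 3 => if i.val + j.val + 1 = 3 then (1 : L) else 0)).Local v,
      g ∈ I ↔ (((localNonsplitEquiv (IsCMField.complexConj L) (Matrix.of fun i j : Fin 3 => if i.val + j.val + 1 = 3 then (1 : L) else 0)
          (IsCMField.complexConj_ne_one L) w hw) g : ↥(unitaryGroupOfForm (galAdicCompletionMap (L := L) (IsCMField.complexConj L) hw)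
            (placeForm (Matrix.of fun i j : Fin 3 => if i.val + j.val + 1 = 3 then (1 : L) else 0) w.1))) : GL (Fin 3) (w.1.adicCompletion L)) ∈ glInt 3 (w.1.adicCompletion L) ∧
        (((localNonsplitEquiv (IsCMField.complexConj L) (Matrix.of fun i j : Fin 3 => if i.val + j.val + 1 = 3 then (1 : L) else 0)
          (IsCMField.complexConj_ne_one L) w hw) g : ↥(unitaryGroupOfForm (galAdicCompletionMap (L := L) (IsCMField.complexConj L) hw)
            (placeForm (Matrix.of fun i j : Fin 3 => if i.val + j.val + 1 = 3 then (1 : L) else 0) w.1))) : GL (Fin 3) (w.1.adicCompletion L)) ∈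
          (glInt 3 (w.1.adicCompletion L)).map (MulAut.conj g₁).toMonoidHom)
    (hKvo : IsOpen (Kv : Set ((cmDatum L 3 (Matrix.of fun i j : Fin 3 => if i.val + j.val + 1 = 3 then (1 : L) else 0)).Local v))) (hKvc : IsCompact (Kv : Set ((cmDatum L 3 (Matrix.of fun i j : Fin 3 => if i.val + j.val + 1 = 3 then (1 : L) else 0)).Local v)))
    (hKeo : IsOpen (Ke : Set ((cmDatum L 3 (Matrix.of fun i j : Fin 3 => if i.val + j.val + 1 = 3 then (1 : L) else 0)).Local v))) (hKec : IsCompact (Ke : Set ((cmDatum L 3 (Matrix.of fun i j : Fin 3 => if i.val + j.val + 1 = 3 then (1 : L) else 0)).Local v)))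
    (hIo : IsOpen (I : Set ((cmDatum L 3 (Matrix.of fun i j : Fin 3 => if i.val + j.val + 1 = 3 then (1 : L) else 0)).Local v))) (hIc : IsCompact (I : Set ((cmDatum L 3 (Matrix.of fun i j : Fin 3 => if i.val + j.val + 1 = 3 then (1 : L) else 0)).Local v)))
    (hT1 : ∀ γ : (cmDatum L 3 (Matrix.of fun i j : Fin 3 => if i.val + j.val + 1 = 3 then (1 : L) else 0)).Local v,
      IsRegularElt (γ.val : GL (Fin 3) (UnitaryGroup.LocalRing L v)) →
      ¬ CompactSpace (Subgroup.centralizer ({γ} : Set ((cmDatum L 3 (Matrix.of fun i j : Fin 3 => if i.val + j.val + 1 = 3 then (1 : L) else 0)).Local v))) →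
      ∃ (g : (cmDatum L 3 (Matrix.of fun i j : Fin 3 => if i.val + j.val + 1 = 3 then (1 : L) else 0)).Local v) (e : Fin 3 → w.1.adicCompletion L) (c : ℤ),
        ((((localNonsplitEquiv (IsCMField.complexConj L) (Matrix.of fun i j : Fin 3 => if i.val + j.val + 1 = 3 then (1 : L) else 0)
          (IsCMField.complexConj_ne_one L) w hw) (g * γ * g⁻¹) : ↥(unitaryGroupOfForm (galAdicCompletionMap (L := L) (IsCMField.complexConj L) hw)
            (placeForm (Matrix.of fun i j : Fin 3 => if i.val + j.val + 1 = 3 then (1 : L) else 0) w.1))) : GL (Fin 3) (w.1.adicCompletion L)) : Matrix (Fin 3) (Fin 3) (w.1.adicCompletion L)) =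
          diagonal e ∧
        Valued.v (e 0) = Valued.v (ϖ ^ c) ∧ Valued.v (e 1) = 1 ∧ Valued.v (e 2) = Valued.v (ϖ ^ (-c)))
    (hT2 : ∀ δ : (cmDatum L 3 (Matrix.of fun i j : Fin 3 => if i.val + j.val + 1 = 3 then (1 : L) else 0)).Local v,
      IsRegularElt (δ.val : GL (Fin 3) (UnitaryGroup.LocalRing L v)) →
      (∃ e : Fin 3 → w.1.adicCompletion L,
        ((((localNonsplitEquiv (IsCMField.complexConj L) (Matrix.of fun i j : Fin 3 => if i.val + j.val + 1 = 3 then (1 : L) else 0)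
          (IsCMField.complexConj_ne_one L) w hw) δ : ↥(unitaryGroupOfForm (galAdicCompletionMap (L := L) (IsCMField.complexConj L) hw)
            (placeForm (Matrix.of fun i j : Fin 3 => if i.val + j.val + 1 = 3 then (1 : L) else 0) w.1))) : GL (Fin 3) (w.1.adicCompletion L)) : Matrix (Fin 3) (Fin 3) (w.1.adicCompletion L)) =
          diagonal e) →
      ∃ τ : Subgroup.centralizer ({δ} : Set ((cmDatum L 3 (Matrix.of fun i j : Fin 3 => if i.val + j.val + 1 = 3 then (1 : L) else 0)).Local v)),
        ((((localNonsplitEquiv (IsCMField.complexConj L) (Matrix.of fun i j : Fin 3 => if i.val + j.val + 1 = 3 then (1 : L) else 0)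
          (IsCMField.complexConj_ne_one L) w hw) (τ : (cmDatum L 3 (Matrix.of fun i j : Fin 3 => if i.val + j.val + 1 = 3 then (1 : L) else 0)).Local v) :
            ↥(unitaryGroupOfForm (galAdicCompletionMap (L := L) (IsCMField.complexConj L) hw)
            (placeForm (Matrix.of fun i j : Fin 3 => if i.val + j.val + 1 = 3 then (1 : L) else 0) w.1))) : GL (Fin 3) (w.1.adicCompletion L)) : Matrix (Fin 3) (Fin 3) (w.1.adicCompletion L)) =
          diagonal ![ϖ⁻¹, 1, ϖ] ∧
        (∀ c' : Subgroup.centralizer ({δ} : Set ((cmDatum L 3 (Matrix.of fun i j : Fin 3 => if i.val + j.val + 1 = 3 then (1 : L) else 0)).Local v)), ∃ n : ℤ,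
          c' * (τ ^ n)⁻¹ ∈ compactCore (Subgroup.centralizer ({δ} : Set ((cmDatum L 3 (Matrix.of fun i j : Fin 3 => if i.val + j.val + 1 = 3 then (1 : L) else 0)).Local v)))) ∧
        (∀ n : ℤ, τ ^ n ∈ compactCore (Subgroup.centralizer ({δ} : Set ((cmDatum L 3 (Matrix.of fun i j : Fin 3 => if i.val + j.val + 1 = 3 then (1 : L) else 0)).Local v))) → n = 0))
    (γ : (cmDatum L 3 (Matrix.of fun i j : Fin 3 => if i.val + j.val + 1 = 3 then (1 : L) else 0)).Local v) (hreg : IsRegularElt (γ.val : GL (Fin 3) (UnitaryGroup.LocalRing L v)))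
    (hnc : ¬ CompactSpace (Subgroup.centralizer ({γ} : Set ((cmDatum L 3 (Matrix.of fun i j : Fin 3 => if i.val + j.val + 1 = 3 then (1 : L) else 0)).Local v)))) :
    (((ν Kv).toReal : ℂ))⁻¹ * classOrbitalIntegral m ((Kv : Set ((cmDatum L 3 (Matrix.of fun i j : Fin 3 => if i.val + j.val + 1 = 3 then (1 : L) else 0)).Local v)).indicator fun _ => (1 : ℂ)) (ConjClasses.mk γ) +
        (((ν Ke).toReal : ℂ))⁻¹ * classOrbitalIntegral m ((Ke : Set ((cmDatum L 3 (Matrix.of fun i j : Fin 3 => if i.val + j.val + 1 = 3 then (1 : L) else 0)).Local v)).indicator fun _ => (1 : ℂ)) (ConjClasses.mk γ) -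
        (((ν I).toReal : ℂ))⁻¹ * classOrbitalIntegral m ((I : Set ((cmDatum L 3 (Matrix.of fun i j : Fin 3 => if i.val + j.val + 1 = 3 then (1 : L) else 0)).Local v)).indicator fun _ => (1 : ℂ)) (ConjClasses.mk γ) = 0 := by
  have hc1 : IsCMField.complexConj L ≠ 1 := IsCMField.complexConj_ne_one L
  -- names for the one-place data
  set E := w.1.adicCompletion L with hEdef
  set σ : E →+* E := galAdicCompletionMap (L := L) (IsCMField.complexConj L) hw with hσdef
  set eW := (localNonsplitEquiv (IsCMField.complexConj L) (Matrix.of fun i j : Fin 3 => if i.val + j.val + 1 = 3 then (1 : L) else 0)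
          (IsCMField.complexConj_ne_one L) w hw) with heW
  -- `IsRegularElt` is a class function on `U₃`
  have hP : ∀ g x : (cmDatum L 3 (Matrix.of fun i j : Fin 3 => if i.val + j.val + 1 = 3 then (1 : L) else 0)).Local v, IsRegularElt (g.val : GL (Fin 3) (UnitaryGroup.LocalRing L v)) →
      IsRegularElt ((x * g * x⁻¹).val : GL (Fin 3) (UnitaryGroup.LocalRing L v)) := fun g x hg => isRegularElt_val_conj L 3 _ v g x hg
  -- (T1): a regular DIAGONAL representative `δ` of the class of `γ`, with valuation profile `(|ϖ^c|, 1, |ϖ^{−c}|)`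
  obtain ⟨g, e, c, hδm, he₀, he₁, he₂⟩ := hT1 γ hreg hnc
  have hcl : ConjClasses.mk (g * γ * g⁻¹) = ConjClasses.mk γ := ConjClasses.mk_eq_mk_iff_isConj.2 (isConj_iff.2 ⟨g, rfl⟩).symm
  rw [← hcl]
  set δ : (cmDatum L 3 (Matrix.of fun i j : Fin 3 => if i.val + j.val + 1 = 3 then (1 : L) else 0)).Local v := g * γ * g⁻¹ with hδdef
  have hregδ : IsRegularElt (δ.val : GL (Fin 3) (UnitaryGroup.LocalRing L v)) := isRegularElt_val_conj L 3 _ v γ g hreg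
  -- (T2): the split-torus generator `τ ∈ Z(δ)` with (gen), (free)
  obtain ⟨τ, hτm, hgen, hfree⟩ := hT2 δ hregδ ⟨e, hδm⟩
  -- the compact-core facts, the closed class
  obtain ⟨hcomm, hcc, hco⟩ := compactCore_centralizer_local_facts_of_isRegularElt (IsCMField.complexConj L) 3 _ hc1
    (UnitaryGroup.antidiagOne_map_transpose (IsCMField.complexConj L) 3) (isUnit_antidiagOne_det L 3) δ hregδ
  have hO := isClosed_conjClass_local_of_isRegularElt L 3 (Matrix.of fun i j : Fin 3 => if i.val + j.val + 1 = 3 then (1 : L) else 0) v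
    (antidiagOne_isHermitian L 3) (isUnit_antidiagOne_det L 3).ne_zero δ hregδ
  -- ★ THEOREM C₃ at `δ` on the one-place model `e_w` (the `J₀`-spelling cast `placeForm Φ₃ w = (StdForm.antidiagonal 3).over E` is a `subst` inside)
  exact epCombination_classOrbitalIntegral_eq_zero_of_latticeModel_three hP hm hd g₁ hg₁ (placeForm_antidiagThree_eq_over L w) eW.toMulEquiv Kv Ke I
    hKv hKe hI hKvo hKvc hKeo hKec hIo hIc hregδ hO hcomm hcc hco τ hgen hfree hτm hδm he₀ he₁ he₂

end Core

section GenericAnyInvolution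

variable {G : Type*} [Group G] [TopologicalSpace G] [IsTopologicalGroup G] [LocallyCompactSpace G]
  [SecondCountableTopology G] [T2Space G] [MeasurableSpace G] [BorelSpace G]
  [∀ γ : G, MeasurableSpace (G ⧸ Subgroup.centralizer ({γ} : Set G))]
  [∀ γ : G, BorelSpace (G ⧸ Subgroup.centralizer ({γ} : Set G))]
  {K : Type*} [Field K] [Valued K ℤᵐ⁰] [ValuativeRel K] [(Valued.v : Valuation K ℤᵐ⁰).Compatible] {σ : K →+* K} {ϖ : K}

/-! ## §4 (ED. 2) THEOREM C₃ for ANY valuation-preserving involution, transitivities as binders — and at a TAME RAMIFIED place (F0P2-p02 (g25), CENSUS «(G2)∕(G1)-RAM» v2 row C₃-RAM; over ★ P2-RAM p852982) -/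

/-- **THEOREM C₃ FOR ANY VALUATION-PRESERVING INVOLUTION, (A)(B)(I) AS BINDERS.**  `G` locally compact with a Haar measure `ν` and a canonical orbital family `m` for a class
predicate `P`; `σ` an involution of `K` with `|σ·| = |·|`, `|ϖ| = exp(−1)`, `g₁ = diag(1,1,ϖ)`; (A) `hA`, (B) `hB`, (I) `hflag` the three transitivities of `U(σ, J₀)` on self-dual vertices,
type-two vertices and flags of the lattice tree (★ P1's currency); a lattice MODEL `eU : G ≃* U(σ, H′)`, `hH′ : H′ = J₀`; levels `Kv, Ke, I ≤ G` compact open, by membership through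
`eU` (`GL₃(𝒪)`, `g₁GL₃(𝒪)g₁⁻¹`, both); `δ ∈ G` with `P δ`, closed class, commutative centraliser with compact open compact core, `eU δ` DIAGONAL of valuation profile
`(|ϖ^c|, 1, |ϖ^{−c}|)`; `τ ∈ Z_G(δ)` with `eU τ = diag(ϖ⁻¹, 1, σϖ)` and (gen)∕(free).  Then
`((ν Kv).toReal : ℂ)⁻¹ Φ(⟦δ⟧, 𝟙_{Kv}) + ((ν Ke).toReal : ℂ)⁻¹ Φ(⟦δ⟧, 𝟙_{Ke}) − ((ν I).toReal : ℂ)⁻¹ Φ(⟦δ⟧, 𝟙_I) = 0` — THEOREM C₃'s conclusion token for token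
(★ engine ×3, volumes cancelled, ★ `natCard_quotient_fixedBy_add_eq_natCard_quotient_fixedBy_inf_three_of_transitive`).
[cite: Kottwitz1988, §2 Theorem 2] [cite: Laumon1995, Lemma (5.3.2) p. 136] [cite: Serre1980Trees, I.6.4; II.1.1] -/
theorem epCombination_classOrbitalIntegral_eq_zero_of_latticeModel_three_of_transitive {P : G → Prop} (hP : ∀ g x : G, P g → P (x * g * x⁻¹))
    {ν : Measure G} [ν.IsHaarMeasure] [ν.IsMulRightInvariant] {m : OrbitalMeasureFamily G} (hm : m.IsCanonical P ν)
    (hσ : ∀ x, σ (σ x) = x) (hvσ : ∀ a, Valued.v (σ a) = Valued.v a) (hϖ : Valued.v ϖ = WithZero.exp (-1 : ℤ))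
    (g₁ : GL (Fin 3) K) (hg₁ : (g₁ : Matrix (Fin 3) (Fin 3) K) = diagonal ![(1 : K), 1, ϖ])
    (hA : ∀ M : Submodule (Valued.integer K) (Fin 3 → K), IsSelfDualLattice σ ϖ ((StdForm.antidiagonal 3).over K) M →
      ∃ u : ↥(unitaryGroupOfForm σ ((StdForm.antidiagonal 3).over K)), mapGL (u : GL (Fin 3) K) (stdLattice K 3) = M)
    (hB : ∀ M : Submodule (Valued.integer K) (Fin 3 → K), IsVertexLattice σ ϖ ((StdForm.antidiagonal 3).over K) 2 M →
      ∃ u : ↥(unitaryGroupOfForm σ ((StdForm.antidiagonal 3).over K)), mapGL ((u : GL (Fin 3) K) * g₁) (stdLattice K 3) = M)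
    (hflag : ∀ L M : Submodule (Valued.integer K) (Fin 3 → K), IsSelfDualLattice σ ϖ ((StdForm.antidiagonal 3).over K) L →
      IsVertexLattice σ ϖ ((StdForm.antidiagonal 3).over K) 2 M → M < L →
      ∃ u : ↥(unitaryGroupOfForm σ ((StdForm.antidiagonal 3).over K)), mapGL (u : GL (Fin 3) K) (stdLattice K 3) = L ∧ mapGL ((u : GL (Fin 3) K) * g₁) (stdLattice K 3) = M)
    {H' : Matrix (Fin 3) (Fin 3) K} (hH' : H' = (StdForm.antidiagonal 3).over K) (eU : G ≃* ↥(unitaryGroupOfForm σ H')) (Kv Ke I : Subgroup G)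
    (hKv : ∀ g : G, g ∈ Kv ↔ ((eU g : ↥(unitaryGroupOfForm σ H')) : GL (Fin 3) K) ∈ glInt 3 K)
    (hKe : ∀ g : G, g ∈ Ke ↔ ((eU g : ↥(unitaryGroupOfForm σ H')) : GL (Fin 3) K) ∈ (glInt 3 K).map (MulAut.conj g₁).toMonoidHom)
    (hI : ∀ g : G, g ∈ I ↔ ((eU g : ↥(unitaryGroupOfForm σ H')) : GL (Fin 3) K) ∈ glInt 3 K ∧ ((eU g : ↥(unitaryGroupOfForm σ H')) : GL (Fin 3) K) ∈ (glInt 3 K).map (MulAut.conj g₁).toMonoidHom)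
    (hKvo : IsOpen (Kv : Set G)) (hKvc : IsCompact (Kv : Set G)) (hKeo : IsOpen (Ke : Set G)) (hKec : IsCompact (Ke : Set G))
    (hIo : IsOpen (I : Set G)) (hIc : IsCompact (I : Set G))
    {δ : G} (hδ : P δ) (hO : IsClosed {g | ∃ y : G, y * δ * y⁻¹ = g})
    (hcomm : ∀ a b : Subgroup.centralizer ({δ} : Set G), a * b = b * a)
    (hc : IsCompact (compactCore (Subgroup.centralizer ({δ} : Set G)))) (ho : IsOpen (compactCore (Subgroup.centralizer ({δ} : Set G))))
    (τ : Subgroup.centralizer ({δ} : Set G))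
    (hgen : ∀ c' : Subgroup.centralizer ({δ} : Set G), ∃ n : ℤ, c' * (τ ^ n)⁻¹ ∈ compactCore (Subgroup.centralizer ({δ} : Set G)))
    (hfree : ∀ n : ℤ, τ ^ n ∈ compactCore (Subgroup.centralizer ({δ} : Set G)) → n = 0)
    (hτm : (((eU (τ : G) : ↥(unitaryGroupOfForm σ H')) : GL (Fin 3) K) : Matrix (Fin 3) (Fin 3) K) = diagonal ![ϖ⁻¹, 1, σ ϖ]) {e : Fin 3 → K}
    (hδm : (((eU δ : ↥(unitaryGroupOfForm σ H')) : GL (Fin 3) K) : Matrix (Fin 3) (Fin 3) K) = diagonal e) {c : ℤ}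
    (he₀ : Valued.v (e 0) = Valued.v (ϖ ^ c)) (he₁ : Valued.v (e 1) = 1) (he₂ : Valued.v (e 2) = Valued.v (ϖ ^ (-c))) :
    (((ν Kv).toReal : ℂ))⁻¹ * classOrbitalIntegral m ((Kv : Set G).indicator fun _ => (1 : ℂ)) (ConjClasses.mk δ) +
        (((ν Ke).toReal : ℂ))⁻¹ * classOrbitalIntegral m ((Ke : Set G).indicator fun _ => (1 : ℂ)) (ConjClasses.mk δ) -
        (((ν I).toReal : ℂ))⁻¹ * classOrbitalIntegral m ((I : Set G).indicator fun _ => (1 : ℂ)) (ConjClasses.mk δ) = 0 := by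
  subst hH'
  rw [classOrbitalIntegral_indicator_complex_eq_mul_natCard_quotient_zpowers hP hm hδ hcomm hc ho τ hgen hfree Kv hKvo hKvc hO,
    classOrbitalIntegral_indicator_complex_eq_mul_natCard_quotient_zpowers hP hm hδ hcomm hc ho τ hgen hfree Ke hKeo hKec hO,
    classOrbitalIntegral_indicator_complex_eq_mul_natCard_quotient_zpowers hP hm hδ hcomm hc ho τ hgen hfree I hIo hIc hO]
  have hfinA := (classOrbitalIntegral_indicator_eq_mul_natCard_quotient_zpowers hP hm hδ hcomm hc ho τ hgen hfree Kv hKvo hKvc hO).1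
  have hfinB := (classOrbitalIntegral_indicator_eq_mul_natCard_quotient_zpowers hP hm hδ hcomm hc ho τ hgen hfree Ke hKeo hKec hO).1
  rw [← mul_assoc, ← mul_assoc, ← mul_assoc, inv_mul_cancel₀ (complex_toReal_measure_ne_zero_of_isOpen_isCompact ν Kv hKvo hKvc),
    inv_mul_cancel₀ (complex_toReal_measure_ne_zero_of_isOpen_isCompact ν Ke hKeo hKec), inv_mul_cancel₀ (complex_toReal_measure_ne_zero_of_isOpen_isCompact ν I hIo hIc),
    one_mul, one_mul, one_mul, sub_eq_zero, ← Nat.cast_add, Nat.cast_inj]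
  have hτ : (τ : G) * δ = δ * (τ : G) := Subgroup.mem_centralizer_singleton_iff.1 τ.2
  have hτeq : (⟨(τ : G), Subgroup.mem_centralizer_singleton_iff.2 hτ⟩ : Subgroup.centralizer ({δ} : Set G)) = τ := Subtype.ext rfl
  have key := natCard_quotient_fixedBy_add_eq_natCard_quotient_fixedBy_inf_three_of_transitive hσ hvσ hϖ g₁ hg₁ hA hB hflag eU Kv Ke I hKv hKe hI
    (τ : G) δ hτm hδm he₀ he₁ he₂ hτ
  rw [hτeq] at key
  exact key hfinA hfinB



/-- **THEOREM C₃ AT A TAME RAMIFIED PLACE («C₃-RAM»).**  The binder block `(hσ) (hvσ) (hϖ) (hσϖ : σ ϖ = −ϖ) (hres) (h2 : |2| = 1) (hnorm)` of ★ `isTree_latticeGraph_three_of_neg`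
VERBATIM replaces THEOREM C₃'s `hd : UnramifiedLocalConjDatum σ ϖ`, and `eU τ = diag(ϖ⁻¹, 1, σϖ) (= diag(ϖ⁻¹, 1, −ϖ))` its translation; everything else and the conclusion token
for token.  PROOF: §1 with (A)(B)(I) discharged as in ★ P2-RAM `…_of_neg` — equivalently ★ engine ×3 + ★ `natCard_quotient_fixedBy_add_eq_natCard_quotient_fixedBy_inf_three_of_neg`.
With ★ `natCard_fixedBy_add_eq_natCard_fixedBy_inf_add_one_three_of_neg` («EULER-G-RAM») this is the `hN` relation of ★ `RankOneEulerPoincareGlue` on any model of the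
quasi-split `U(3)` at a TAME RAMIFIED place. [cite: Kottwitz1988, §2 Theorem 2] [cite: Laumon1995, Lemma (5.3.2) p. 136] [cite: Serre1980Trees, I.6.4; II.1.1] [cite: Tits1979, §2.4, §3.5] -/
theorem epCombination_classOrbitalIntegral_eq_zero_of_latticeModel_three_of_neg {P : G → Prop} (hP : ∀ g x : G, P g → P (x * g * x⁻¹))
    {ν : Measure G} [ν.IsHaarMeasure] [ν.IsMulRightInvariant] {m : OrbitalMeasureFamily G} (hm : m.IsCanonical P ν)
    (hσ : ∀ x, σ (σ x) = x) (hvσ : ∀ a, Valued.v (σ a) = Valued.v a) (hϖ : Valued.v ϖ = WithZero.exp (-1 : ℤ)) (hσϖ : σ ϖ = -ϖ)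
    (hres : ∀ x : K, Valued.v x ≤ 1 → Valued.v (σ x - x) < 1) (h2 : Valued.v (2 : K) = 1)
    (hnorm : ∀ u : K, σ u = u → Valued.v (u - 1) < 1 → ∃ z : K, z * σ z = u ∧ Valued.v (z - 1) ≤ Valued.v (u - 1))
    (g₁ : GL (Fin 3) K) (hg₁ : (g₁ : Matrix (Fin 3) (Fin 3) K) = diagonal ![(1 : K), 1, ϖ])
    {H' : Matrix (Fin 3) (Fin 3) K} (hH' : H' = (StdForm.antidiagonal 3).over K) (eU : G ≃* ↥(unitaryGroupOfForm σ H')) (Kv Ke I : Subgroup G)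
    (hKv : ∀ g : G, g ∈ Kv ↔ ((eU g : ↥(unitaryGroupOfForm σ H')) : GL (Fin 3) K) ∈ glInt 3 K)
    (hKe : ∀ g : G, g ∈ Ke ↔ ((eU g : ↥(unitaryGroupOfForm σ H')) : GL (Fin 3) K) ∈ (glInt 3 K).map (MulAut.conj g₁).toMonoidHom)
    (hI : ∀ g : G, g ∈ I ↔ ((eU g : ↥(unitaryGroupOfForm σ H')) : GL (Fin 3) K) ∈ glInt 3 K ∧ ((eU g : ↥(unitaryGroupOfForm σ H')) : GL (Fin 3) K) ∈ (glInt 3 K).map (MulAut.conj g₁).toMonoidHom)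
    (hKvo : IsOpen (Kv : Set G)) (hKvc : IsCompact (Kv : Set G)) (hKeo : IsOpen (Ke : Set G)) (hKec : IsCompact (Ke : Set G))
    (hIo : IsOpen (I : Set G)) (hIc : IsCompact (I : Set G))
    {δ : G} (hδ : P δ) (hO : IsClosed {g | ∃ y : G, y * δ * y⁻¹ = g})
    (hcomm : ∀ a b : Subgroup.centralizer ({δ} : Set G), a * b = b * a)
    (hc : IsCompact (compactCore (Subgroup.centralizer ({δ} : Set G)))) (ho : IsOpen (compactCore (Subgroup.centralizer ({δ} : Set G))))
    (τ : Subgroup.centralizer ({δ} : Set G))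
    (hgen : ∀ c' : Subgroup.centralizer ({δ} : Set G), ∃ n : ℤ, c' * (τ ^ n)⁻¹ ∈ compactCore (Subgroup.centralizer ({δ} : Set G)))
    (hfree : ∀ n : ℤ, τ ^ n ∈ compactCore (Subgroup.centralizer ({δ} : Set G)) → n = 0)
    (hτm : (((eU (τ : G) : ↥(unitaryGroupOfForm σ H')) : GL (Fin 3) K) : Matrix (Fin 3) (Fin 3) K) = diagonal ![ϖ⁻¹, 1, σ ϖ]) {e : Fin 3 → K}
    (hδm : (((eU δ : ↥(unitaryGroupOfForm σ H')) : GL (Fin 3) K) : Matrix (Fin 3) (Fin 3) K) = diagonal e) {c : ℤ}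
    (he₀ : Valued.v (e 0) = Valued.v (ϖ ^ c)) (he₁ : Valued.v (e 1) = 1) (he₂ : Valued.v (e 2) = Valued.v (ϖ ^ (-c))) :
    (((ν Kv).toReal : ℂ))⁻¹ * classOrbitalIntegral m ((Kv : Set G).indicator fun _ => (1 : ℂ)) (ConjClasses.mk δ) +
        (((ν Ke).toReal : ℂ))⁻¹ * classOrbitalIntegral m ((Ke : Set G).indicator fun _ => (1 : ℂ)) (ConjClasses.mk δ) -
        (((ν I).toReal : ℂ))⁻¹ * classOrbitalIntegral m ((I : Set G).indicator fun _ => (1 : ℂ)) (ConjClasses.mk δ) = 0 := by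
  have hN₁ : mapGL g₁ (stdLattice K 3) = latt (diagonal ![(1 : K), 1, ϖ]) := by rw [← hg₁]; rfl
  have hA : ∀ M : Submodule (Valued.integer K) (Fin 3 → K), IsSelfDualLattice σ ϖ ((StdForm.antidiagonal 3).over K) M →
      ∃ u : ↥(unitaryGroupOfForm σ ((StdForm.antidiagonal 3).over K)), mapGL (u : GL (Fin 3) K) (stdLattice K 3) = M := fun M hM => by
    obtain ⟨u, hu⟩ := exists_unitary_mapGL_stdLattice_eq_of_isSelfDualLattice_of_v_two hσ hvσ hϖ h2 hM
    exact ⟨u, hu.symm⟩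
  have hB : ∀ M : Submodule (Valued.integer K) (Fin 3 → K), IsVertexLattice σ ϖ ((StdForm.antidiagonal 3).over K) 2 M →
      ∃ u : ↥(unitaryGroupOfForm σ ((StdForm.antidiagonal 3).over K)), mapGL ((u : GL (Fin 3) K) * g₁) (stdLattice K 3) = M := fun M hM => by
    obtain ⟨u, hu⟩ := forall_isVertexLattice_two_exists_mapGL_N₁_eq_of_neg hσ hvσ hϖ hσϖ hres h2 hnorm M hM
    exact ⟨u, by rw [mapGL_mul, hN₁, hu]⟩
  exact epCombination_classOrbitalIntegral_eq_zero_of_latticeModel_three_of_transitive hP hm hσ hvσ hϖ g₁ hg₁ hA hB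
    (forall_flag_exists_unitary_of_v_two hσ hvσ hϖ h2 g₁ hg₁) hH' eU Kv Ke I hKv hKe hI hKvo hKvc hKeo hKec hIo hIc hδ hO hcomm hc ho τ hgen hfree hτm hδm he₀ he₁ he₂

end GenericAnyInvolution

end Literature.NumberTheory.Rogawski1990

end
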